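/-
Copyright (c) 2026. All rights reserved.
Released under Apache 2.0 license as described in the file LICENSE.
Authors: abc-iut cell, wave-4 seat abc-iut-w4-d064 (proof-only; [SemiAnbd] Cor 3.9 step R3, sub-node R3a).
-/
import Literature.AnabelianGeometry.SemiGraphs.TemperedFunctorialityWith
import Literature.AnabelianGeometry.SemiGraphs.TemperedEdgeInVerticialProofs
import Literature.AnabelianGeometry.SemiGraphs.TemperedFunctorialityProofs
import Literature.AnabelianGeometry.SemiGraphs.TemperoidsGaloisObjectsProofs
import Literature.AnabelianGeometry.SemiGraphs.ProfiniteHomToAnabPullback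
import HarnessLib

/-!
# [SemiAnbd] Cor 3.9, step R3 (R3a `TwistAbsorption`): the assembly lemma

Mochizuki, *Semi-graphs of anabelioids*, Publ. RIMS **42** (2006) [MochizukiSemiAnbd2006], Cor 3.9,
proof p. 43 ll. 12–13: "by varying `G'`, `H'`, we conclude that `φ` arises from a morphism of graphs of
anabelioids".  For `F : G → H` with a family `θ` of conjugating elements (the 2-cells, Rmk 2.4.2),
charts `c_G`, `c_H` and `φ : π₁^temp(G) → π₁^temp(H)`, this PROOF-ONLY file (abc-iut cell, wave-4 seat
abc-iut-w4-d064; sub-node R3a of abc-iut-w4-d080's `TemperedReconstructionR3Sub.lean`) proves the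
ASSEMBLY LEMMA `Hom.nonempty_chartPullbackWith_iso_of_data`: given
* verticial / edge homomorphisms of `G` and `H` with their chart isomorphisms (Thm 3.7 (i), (iii)),
* the gluing elements `λ_b ∈ π₁^temp(G)`, `λ'_{F b} ∈ π₁^temp(H)` of the two charts WITH their
  pointwise description (`TemperedChartGlueElements.lean`: the chart's gluing along a branch is
  translation by one element — Prop 3.2),
* fibre conjugators `g_v`, `g_e` (`g ψ'(F_v π) g⁻¹ = φ(ψ_v π)` — the compatibility of `φ` with `F` on
  the verticial and edge homomorphisms, `Hom.CompatV` / `Hom.CompatE`), and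
* the branch identities `φ(λ_b) · g_e = g_v · ψ'_{F v}(θ_b) · λ'_{F b}`,
the pull-back functor through the charts `c_H⁻¹ ⋙ F^*_θ ⋙ c_G` is isomorphic to `B^temp(φ)`.  Proof:
the fibres of `F^*_θ(c_H⁻¹ X)` and of `c_G⁻¹(B^temp(φ) X)` are identified by translation by `g_v`,
`g_e` (`BTemp.resIsoOfConj`); the gluing squares commute pointwise because both gluings are
translations (the chart gluing elements, and `covPullbackWith_glue_apply`) and the branch identities
hold; `CovObj.isoOfComponents` + naturality assemble the natural isomorphism, and the counit of the
chart `c_G` finishes.  No definitions; nothing here bears on [IUTchIII] Cor. 3.12.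
-/

noncomputable section

namespace Literature.AnabelianGeometry.SemiGraphs

open CategoryTheory Topology
open Literature.AlgebraicGeometry.Frobenioids.QuasiTemperoid.BTempConnected (hom_ρ hom_ext_apply
  ρ_mul_apply)
open GaloisObjects (iso_inv_hom_apply iso_hom_inv_apply)

universe u

namespace ProfiniteSemiGraph

namespace Hom

variable {𝒢 ℋ : ProfiniteSemiGraph.{u}} (F : Hom 𝒢 ℋ) (θ : F.ConjugatorFamily)
  (c𝒢 : TemperedPiChart 𝒢) (cℋ : TemperedPiChart ℋ) (φ : c𝒢.G →ₜ* cℋ.G)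

/-- **Assembly lemma** for (R3a): given chart data for `G` and `H` (verticial/edge homomorphisms with
their chart isomorphisms and the gluing elements `λ_b`, `λ'_{F b}` with their pointwise formulas),
fibre conjugators `g_v`, `g_e` (compatibility of `φ` with `F`), and a family `θ` for which the branch
identities `φ(λ_b) · g_e = g_v · ψ'_{F v}(θ_b) · λ'_{F b}` hold, the pull-back functor `F^*_θ` through
the charts is isomorphic to `B^temp(φ)`. [cite: MochizukiSemiAnbd2006, Cor 3.9 p.43] -/
theorem nonempty_chartPullbackWith_iso_of_data
    (ψV : ∀ v : 𝒢.graph.Vertex, 𝒢.Gv v →ₜ* c𝒢.G)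
    (iV : ∀ v, c𝒢.equiv.inverse ⋙ ObjectProperty.ι _ ⋙ restrictV 𝒢 v ≅ BTemp.res (ψV v))
    (ψE : ∀ e : 𝒢.graph.Edge, 𝒢.Ge e →ₜ* c𝒢.G)
    (iE : ∀ e, c𝒢.equiv.inverse ⋙ ObjectProperty.ι _ ⋙ restrictE 𝒢 e ≅ BTemp.res (ψE e))
    (ψV' : ∀ w : ℋ.graph.Vertex, ℋ.Gv w →ₜ* cℋ.G)
    (iV' : ∀ w, cℋ.equiv.inverse ⋙ ObjectProperty.ι _ ⋙ restrictV ℋ w ≅ BTemp.res (ψV' w))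
    (ψE' : ∀ f : ℋ.graph.Edge, ℋ.Ge f →ₜ* cℋ.G)
    (iE' : ∀ f, cℋ.equiv.inverse ⋙ ObjectProperty.ι _ ⋙ restrictE ℋ f ≅ BTemp.res (ψE' f))
    (gV : 𝒢.graph.Vertex → cℋ.G)
    (hgV : ∀ v π, gV v * ψV' (F.base.vertexMap v) (F.hV v π) * (gV v)⁻¹ = φ (ψV v π))
    (gE : 𝒢.graph.Edge → cℋ.G)
    (hgE : ∀ e a, gE e * ψE' (F.base.edgeMap e) (F.hE e a) * (gE e)⁻¹ = φ (ψE e a))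
    (lam : ∀ (b : 𝒢.graph.Branch) (v : 𝒢.graph.Vertex), 𝒢.graph.abuts b = some v → c𝒢.G)
    (hlam : ∀ (b : 𝒢.graph.Branch) (v : 𝒢.graph.Vertex) (h : 𝒢.graph.abuts b = some v)
      (Y : BTemp c𝒢.G) (y : Y.obj.V),
      ((iV v).hom.app Y).hom.hom
          (((c𝒢.equiv.inverse.obj Y).obj.glue b v h).hom.hom.hom
            (((iE (𝒢.graph.edgeOf b)).inv.app Y).hom.hom y)) =
        Y.obj.ρ (lam b v h) y)
    (lam' : ∀ (b : 𝒢.graph.Branch) (v : 𝒢.graph.Vertex), 𝒢.graph.abuts b = some v → cℋ.G)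
    (hlam' : ∀ (b : 𝒢.graph.Branch) (v : 𝒢.graph.Vertex) (h : 𝒢.graph.abuts b = some v)
      (X : BTemp cℋ.G) (x : X.obj.V),
      ((iV' (F.base.vertexMap v)).hom.app X).hom.hom
          (((cℋ.equiv.inverse.obj X).obj.glue (F.base.branchMap b) (F.base.vertexMap v)
              (F.base.abuts_branchMap b v h)).hom.hom.hom
            (F.base.edgeOf_branchMap b ▸
              ((iE' (F.base.edgeMap (𝒢.graph.edgeOf b))).inv.app X).hom.hom x)) =
        X.obj.ρ (lam' b v h) x)
    (hC : ∀ (b : 𝒢.graph.Branch) (v : 𝒢.graph.Vertex) (h : 𝒢.graph.abuts b = some v),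
      φ (lam b v h) * gE (𝒢.graph.edgeOf b) =
        gV v * ψV' (F.base.vertexMap v) (θ.θ b v h) * lam' b v h) :
    Nonempty (F.chartPullbackWith θ c𝒢 cℋ ≅ BTemp.res φ) := by
  -- the natural isomorphisms on vertex fibres: translation by `g_v`
  let eV : ∀ v : 𝒢.graph.Vertex,
      (cℋ.equiv.inverse ⋙ F.btempPullbackWith θ) ⋙ ObjectProperty.ι _ ⋙ restrictV 𝒢 v ≅
        (BTemp.res φ ⋙ c𝒢.equiv.inverse) ⋙ ObjectProperty.ι _ ⋙ restrictV 𝒢 v := fun v =>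
    (show (cℋ.equiv.inverse ⋙ F.btempPullbackWith θ) ⋙ ObjectProperty.ι _ ⋙ restrictV 𝒢 v ≅
        (cℋ.equiv.inverse ⋙ ObjectProperty.ι _ ⋙ restrictV ℋ (F.base.vertexMap v)) ⋙
          BTemp.res (F.hV v) from Iso.refl _) ≪≫
      Functor.isoWhiskerRight (iV' (F.base.vertexMap v)) (BTemp.res (F.hV v)) ≪≫
      BTemp.resComp (ψV' (F.base.vertexMap v)) (F.hV v) ≪≫
      BTemp.resIsoOfConj ((ψV' (F.base.vertexMap v)).comp (F.hV v)) (φ.comp (ψV v)) (gV v) (hgV v) ≪≫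
      (BTemp.resComp φ (ψV v)).symm ≪≫
      Functor.isoWhiskerLeft (BTemp.res φ) (iV v).symm ≪≫
      (show BTemp.res φ ⋙ (c𝒢.equiv.inverse ⋙ ObjectProperty.ι _ ⋙ restrictV 𝒢 v) ≅
        (BTemp.res φ ⋙ c𝒢.equiv.inverse) ⋙ ObjectProperty.ι _ ⋙ restrictV 𝒢 v from Iso.refl _)
  have eV_apply : ∀ (v : 𝒢.graph.Vertex) (X : BTemp cℋ.G)
      (s : (((cℋ.equiv.inverse ⋙ F.btempPullbackWith θ).obj X).obj.SV v).obj.V),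
      (((eV v).hom.app X).hom.hom s) =
        ((iV v).inv.app ((BTemp.res φ).obj X)).hom.hom
          (X.obj.ρ (gV v) (((iV' (F.base.vertexMap v)).hom.app X).hom.hom s)) := fun v X s => rfl
  -- the natural isomorphisms on edge fibres: translation by `g_e`
  let eE : ∀ e : 𝒢.graph.Edge,
      (cℋ.equiv.inverse ⋙ F.btempPullbackWith θ) ⋙ ObjectProperty.ι _ ⋙ restrictE 𝒢 e ≅
        (BTemp.res φ ⋙ c𝒢.equiv.inverse) ⋙ ObjectProperty.ι _ ⋙ restrictE 𝒢 e := fun e =>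
    (show (cℋ.equiv.inverse ⋙ F.btempPullbackWith θ) ⋙ ObjectProperty.ι _ ⋙ restrictE 𝒢 e ≅
        (cℋ.equiv.inverse ⋙ ObjectProperty.ι _ ⋙ restrictE ℋ (F.base.edgeMap e)) ⋙
          BTemp.res (F.hE e) from Iso.refl _) ≪≫
      Functor.isoWhiskerRight (iE' (F.base.edgeMap e)) (BTemp.res (F.hE e)) ≪≫
      BTemp.resComp (ψE' (F.base.edgeMap e)) (F.hE e) ≪≫
      BTemp.resIsoOfConj ((ψE' (F.base.edgeMap e)).comp (F.hE e)) (φ.comp (ψE e)) (gE e) (hgE e) ≪≫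
      (BTemp.resComp φ (ψE e)).symm ≪≫
      Functor.isoWhiskerLeft (BTemp.res φ) (iE e).symm ≪≫
      (show BTemp.res φ ⋙ (c𝒢.equiv.inverse ⋙ ObjectProperty.ι _ ⋙ restrictE 𝒢 e) ≅
        (BTemp.res φ ⋙ c𝒢.equiv.inverse) ⋙ ObjectProperty.ι _ ⋙ restrictE 𝒢 e from Iso.refl _)
  have eE_apply : ∀ (e : 𝒢.graph.Edge) (X : BTemp cℋ.G)
      (x : (((cℋ.equiv.inverse ⋙ F.btempPullbackWith θ).obj X).obj.SE e).obj.V),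
      (((eE e).hom.app X).hom.hom x) =
        ((iE e).inv.app ((BTemp.res φ).obj X)).hom.hom
          (X.obj.ρ (gE e) (((iE' (F.base.edgeMap e)).hom.app X).hom.hom x)) := fun e X x => rfl
  -- per object of `B^temp(π₁^temp H)`, an isomorphism of coverings of `G`
  have comm : ∀ (X : BTemp cℋ.G) (b : 𝒢.graph.Branch) (v : 𝒢.graph.Vertex)
      (h : 𝒢.graph.abuts b = some v),
      ((eE (𝒢.graph.edgeOf b)).app X).hom ≫
          ((c𝒢.equiv.inverse.obj ((BTemp.res φ).obj X)).obj.glue b v h).hom =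
        (((F.btempPullbackWith θ).obj (cℋ.equiv.inverse.obj X)).obj.glue b v h).hom ≫
          (BTemp.res (𝒢.brHom b v h)).map ((eV v).app X).hom := by
    intro X b v h
    apply hom_ext_apply
    intro x
    -- apply the bijection `iV_v` at `B^temp(φ) X`
    have h1 : ∀ s, (((iV v).inv.app ((BTemp.res φ).obj X)).hom.hom
        ((((iV v).hom.app ((BTemp.res φ).obj X))).hom.hom s)) = s :=
      fun s => iso_inv_hom_apply ((iV v).app ((BTemp.res φ).obj X)) s
    have hinj : Function.Injective
        (fun s => (((iV v).hom.app ((BTemp.res φ).obj X)).hom.hom s : X.obj.V)) := by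
      intro s t hst
      have := congrArg (fun y => ((iV v).inv.app ((BTemp.res φ).obj X)).hom.hom y) hst
      dsimp only at this
      rwa [h1, h1] at this
    apply hinj
    change ((iV v).hom.app ((BTemp.res φ).obj X)).hom.hom
        (((c𝒢.equiv.inverse.obj ((BTemp.res φ).obj X)).obj.glue b v h).hom.hom.hom
          (((eE (𝒢.graph.edgeOf b)).hom.app X).hom.hom x)) =
      ((iV v).hom.app ((BTemp.res φ).obj X)).hom.hom
        ((((eV v).hom.app X)).hom.hom
          ((((F.btempPullbackWith θ).obj (cℋ.equiv.inverse.obj X)).obj.glue b v h).hom.hom.hom x))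
    have hhi : ∀ y : X.obj.V,
        (((iV v).hom.app ((BTemp.res φ).obj X)).hom.hom
          ((((iV v).inv.app ((BTemp.res φ).obj X))).hom.hom y) : X.obj.V) = y :=
      fun y => iso_hom_inv_apply ((iV v).app ((BTemp.res φ).obj X)) y
    rw [eE_apply, hlam, eV_apply, hhi]
    -- the pull-back's gluing: glue of `c_H⁻¹ X` along `F b`, then the action of `θ_b`
    have hglue := F.covPullbackWith_glue_apply θ (cℋ.equiv.inverse.obj X).obj b v h x
    have hρ' : ∀ s, ((iV' (F.base.vertexMap v)).hom.app X).hom.hom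
        (((cℋ.equiv.inverse.obj X).obj.SV (F.base.vertexMap v)).obj.ρ (θ.θ b v h) s) =
          X.obj.ρ (ψV' (F.base.vertexMap v) (θ.θ b v h))
            (((iV' (F.base.vertexMap v)).hom.app X).hom.hom s) :=
      fun s => hom_ρ ((iV' (F.base.vertexMap v)).hom.app X) _ s
    -- rewrite `x` as `iE'⁻¹ (iE' x)` to use the gluing element of the chart of `H`
    have hx : x = ((iE' (F.base.edgeMap (𝒢.graph.edgeOf b))).inv.app X).hom.hom
        ((((iE' (F.base.edgeMap (𝒢.graph.edgeOf b))).hom.app X)).hom.hom x) :=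
      (iso_inv_hom_apply ((iE' _).app X) x).symm
    change X.obj.ρ (φ (lam b v h)) (X.obj.ρ (gE (𝒢.graph.edgeOf b))
        (((iE' (F.base.edgeMap (𝒢.graph.edgeOf b))).hom.app X).hom.hom x)) =
      X.obj.ρ (gV v) (((iV' (F.base.vertexMap v)).hom.app X).hom.hom
        ((((F.covPullbackWith θ).obj (cℋ.equiv.inverse.obj X).obj).glue b v h).hom.hom.hom x))
    rw [hglue, hρ']
    conv_rhs => rw [hx]
    rw [hlam' b v h X]
    simp only [← ρ_mul_apply, hC b v h, mul_assoc]
  -- the natural isomorphism `c_H⁻¹ ⋙ F^*_θ ≅ B^temp(φ) ⋙ c_G⁻¹` of functors into `B^temp(G)`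
  let iso : cℋ.equiv.inverse ⋙ F.btempPullbackWith θ ≅ BTemp.res φ ⋙ c𝒢.equiv.inverse :=
    NatIso.ofComponents
      (fun X => (ObjectProperty.fullyFaithfulι _).preimageIso
        (CovObj.isoOfComponents (fun v => (eV v).app X) (fun e => (eE e).app X) (comm X)))
      (fun {X X'} u => ObjectProperty.hom_ext _
        (CovHom.ext (funext fun v => (eV v).hom.naturality u)
          (funext fun e => (eE e).hom.naturality u)))
  exact ⟨Functor.isoWhiskerRight iso c𝒢.equiv.functor ≪≫ Functor.associator _ _ _ ≪≫
    Functor.isoWhiskerLeft (BTemp.res φ) c𝒢.equiv.counitIso ≪≫ Functor.rightUnitor _⟩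

end Hom

end ProfiniteSemiGraph

end Literature.AnabelianGeometry.SemiGraphs

end
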